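import Summits.HubbardSuperconductivity.HubbardSuperconductivity.Theses.FunctionFieldCertificate
import Summits.HubbardSuperconductivity.HubbardSuperconductivity.Theorems.FunctionFieldCertificateMesoscopicPairOrderDoublingPosition
import Summits.HubbardSuperconductivity.HubbardSuperconductivity.Theorems.FunctionFieldCertificateMesoscopicPairOrderProfilePosition
import Summits.HubbardSuperconductivity.HubbardSuperconductivity.Theorems.FunctionFieldCertificateMesoscopicPairOrderBlockCertificateEndgame
import HarnessLib

/-!
# `MesoscopicPairOrder` (stmt-HubbardSuperconductivity-7331), line `redirect_birth`:
# POINTWISE GLUE — the four stub bodies at ONE common point already give the crux (and the summit)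

Support file for the crux (route `FunctionFieldCertificate`, pole-free half; lead c9 of line
`redirect_birth`). The registered line composes (GS) ∧ (Flat) ⇒ (A) and (Q) ∧ (D) ⇒ (B) with (GS), (Flat)
quantified over ALL `U > 0`, `δ ∈ (0, 1/2)` and (Q) over the whole box `(0,6] × [1/10,3/10]`, although the
landed glue `mesoscopicPairOrder_of_subs` consumes (A) only at (B)'s witness. The wave-1 audits (lead c9)
record the resulting exposure: a refutation of (GS)/(Flat) at ANY single `(U, δ)` — e.g. a pair-density wave
or phase separation at strong coupling — or of (Q) anywhere in the box kills a registered stub without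
touching the crux. This file lands the glue a planner needs to remove that exposure (a reshape restricting
every stub to a box containing (D)'s witness), as theorems:

* `uniformPairOrderAt_of_profileAt_of_seedAt` — at a point: Goldstone profile `(S, A)` + ONE leak-beating
  block scale ⇒ uniform sector pair order there (the pointwise one-scale closure, `a = m₀ - leak`).
* `seedAt_of_superlinearAt` — at a point: super-linear block pair order ⇒ a leak-beating seed for EVERY
  budget `(S, A)` (`C = 12A + 3S + 1`, `ε = 1/(4R₀)`, `m₀ = C/R₀`).
* `profileAt_of_shapeAt_of_flatAt` — at a point: (GS)-body ∧ (Flat)-body ⇒ (A)-body (`profile_of_shape_of_flat`).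
* `meso_and_summit_of_stubBodiesAt` — **at ONE point `(U, δ)`, `U > 0`, `δ ∈ (0,1/2)`: the bodies of
  (GS), (Flat), (Q) and (D) (one `θ > 2`) imply `MesoscopicPairOrder ∧ HubbardSuperconductivity`.**
* `mesoscopicPairOrder_of_boxStubs` — hence the BOX-RESTRICTED line closes the crux: (GS), (Flat), (Q)
  asked only on the box `U ∈ (0,6]`, `δ ∈ [1/10,3/10]` (the latter two verbatim the registered (Q)), and
  (D) verbatim the registered stub, give `MesoscopicPairOrder ∧ HubbardSuperconductivity` — the
  ready-made `MesoscopicPairOrder_of` of a reshaped skeleton in which no stub is exposed outside the box.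

Nothing here proves any stub, piece or the crux (open physics). Sources: Kennedy–Lieb–Shastry, PRL 61
(1988) 2582 [KLS1988PRL]; Dyson–Lieb–Simon, J. Stat. Phys. 18 (1978) 335, Thm 4.2 [DysonLiebSimon1978];
Stein–Shakarchi, *Fourier Analysis* (2003), Ch. 2. Folklore; no definition is introduced.
-/

noncomputable section

-- the summit namespace repeats the problem name by design (D-0017)
set_option linter.dupNamespace false

namespace Summit.HubbardSuperconductivity.HubbardSuperconductivity.Theorems.FunctionFieldCertificate

open Matrix Finset Filter
open Literature.Probability.LatticeModels Literature.MathematicalPhysics.QuantumLattice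
open Summit.HubbardSuperconductivity.HubbardSuperconductivity.Theses.FunctionFieldCertificate
open scoped ComplexOrder ComplexConjugate

/-- **Pointwise one-scale closure, eventual form.** At `(U, δ)`: a Goldstone pair profile with constants
`(S, A)` and a seed `m₀ R₀² ≤ T_{R₀}(ψ)/L²` at ONE block scale with `32ε(Sε + A) + (S + A/ε)/R₀² < m₀`
(each eventually in even `L`, every normalised sector ground state) give uniform sector pair order
`a = m₀ - 32ε(Sε + A) - (S + A/ε)/R₀² > 0` there: `a ≤ Re⟨ψ, Δ_dᴴΔ_d ψ⟩/L⁴`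
(`pairStructureFactor_zero_ge_of_seed_of_profile`). KLS (1988); DLS (1978) Thm 4.2. [folklore] -/
theorem uniformPairOrderAt_of_profileAt_of_seedAt {U δ S A ε m₀ : ℝ} {R₀ L_A L_B : ℕ}
    (hS : 0 ≤ S) (hA : 0 ≤ A) (hR₀ : 0 < R₀) (hε : 0 < ε)
    (hleak : 32 * ε * (S * ε + A) + (S + A / ε) / (R₀ : ℝ) ^ 2 < m₀)
    (hprof : ∀ (L : ℕ) [NeZero L], L_A ≤ L → Even L →
      ∀ ψ : Fock (Orb (FermionTorus 2 L)), star ψ ⬝ᵥ ψ = 1 →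
        IsGroundStateInSector (hubbardTorus 2 L 1 U) (2 * ⌊(1 - δ) * (L : ℝ) ^ 2 / 2⌋₊) 0 ψ →
          ∀ m : TorusSite 2 L, m ≠ 0 →
            pairStructureFactor dWaveFormFactor L ψ m ≤ S + A / Real.sqrt (momentumNormSq L m))
    (hseed : ∀ (L : ℕ) [NeZero L], L_B ≤ L → Even L →
      ∀ ψ : Fock (Orb (FermionTorus 2 L)), star ψ ⬝ᵥ ψ = 1 →
        IsGroundStateInSector (hubbardTorus 2 L 1 U) (2 * ⌊(1 - δ) * (L : ℝ) ^ 2 / 2⌋₊) 0 ψ →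
          m₀ * (R₀ : ℝ) ^ 2 ≤ (∑ x : TorusSite 2 L, ∑ y : TorusSite 2 L,
            (∏ i : Fin 2, max 0 (1 - |(((y i - x i).valMinAbs : ℤ) : ℝ)| / (R₀ : ℝ))) *
              (star (localPair dWaveFormFactor L x *ᵥ ψ) ⬝ᵥ (localPair dWaveFormFactor L y *ᵥ ψ)).re) /
            (L : ℝ) ^ 2) :
    ∃ a : ℝ, 0 < a ∧ ∃ L₀ : ℕ, ∀ (L : ℕ) [NeZero L], L₀ ≤ L → Even L →
      ∀ ψ : Fock (Orb (FermionTorus 2 L)), star ψ ⬝ᵥ ψ = 1 →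
        IsGroundStateInSector (hubbardTorus 2 L 1 U) (2 * ⌊(1 - δ) * (L : ℝ) ^ 2 / 2⌋₊) 0 ψ →
          a ≤ (star ψ ⬝ᵥ Matrix.mulVec (Matrix.conjTranspose (pairField dWaveFormFactor L) *
            pairField dWaveFormFactor L) ψ).re / (L : ℝ) ^ 4 := by
  set a : ℝ := m₀ - 32 * ε * (S * ε + A) - (S + A / ε) / (R₀ : ℝ) ^ 2 with ha_def
  have ha : 0 < a := by rw [ha_def]; linarith
  refine ⟨a, ha, max (max L_A L_B) (2 * R₀), fun L _ hL hE ψ hψ hgs => ?_⟩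
  have hLA : L_A ≤ L := le_trans (le_max_left _ _) (le_of_max_le_left hL)
  have hLB : L_B ≤ L := le_trans (le_max_right _ _) (le_of_max_le_left hL)
  have h2R : 2 * R₀ ≤ L := le_of_max_le_right hL
  have hLpos : (0 : ℝ) < L := Nat.cast_pos.2 (Nat.pos_of_ne_zero (NeZero.ne L))
  have hL2 : (0 : ℝ) < (L : ℝ) ^ 2 := by positivity
  have hcore := pairStructureFactor_zero_ge_of_seed_of_profile R₀ hR₀ h2R hε hS hA ψ
    (hprof L hLA hE ψ hψ hgs) (hseed L hLB hE ψ hψ hgs)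
  rw [pairStructureFactor_zero_eq_re_dotProduct, le_div_iff₀ hL2] at hcore
  rw [le_div_iff₀ (by positivity : (0 : ℝ) < (L : ℝ) ^ 4)]
  calc a * (L : ℝ) ^ 4 = a * (L : ℝ) ^ 2 * (L : ℝ) ^ 2 := by ring
    _ ≤ _ := hcore

/-- **Super-linear block pair order ⇒ a leak-beating seed for every budget, at a point.** If at `(U, δ)`
for every `C` some block scale `R₀ > 0` has `C · R₀ ≤ T_{R₀}(ψ)/L²` eventually, then for all `S, A ≥ 0`
there are `R₀ > 0`, `ε > 0`, `m₀` with `32ε(Sε + A) + (S + A/ε)/R₀² < m₀` and `m₀ R₀² ≤ T_{R₀}(ψ)/L²`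
eventually: ask for `C = 12A + 3S + 1` and put `ε = 1/(4R₀)`, `m₀ = C/R₀` (the pointwise half of
`leakBeatingBlockPairSeed_iff_superlinear`). [folklore] -/
theorem seedAt_of_superlinearAt {U δ : ℝ}
    (hsup : ∀ C : ℝ, ∃ R₀ : ℕ, 0 < R₀ ∧ ∃ L₀ : ℕ, ∀ (L : ℕ) [NeZero L], L₀ ≤ L → Even L →
      ∀ ψ : Fock (Orb (FermionTorus 2 L)), star ψ ⬝ᵥ ψ = 1 →
        IsGroundStateInSector (hubbardTorus 2 L 1 U) (2 * ⌊(1 - δ) * (L : ℝ) ^ 2 / 2⌋₊) 0 ψ →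
          C * (R₀ : ℝ) ≤ (∑ x : TorusSite 2 L, ∑ y : TorusSite 2 L,
            (∏ i : Fin 2, max 0 (1 - |(((y i - x i).valMinAbs : ℤ) : ℝ)| / (R₀ : ℝ))) *
              (star (localPair dWaveFormFactor L x *ᵥ ψ) ⬝ᵥ (localPair dWaveFormFactor L y *ᵥ ψ)).re) /
            (L : ℝ) ^ 2)
    (S A : ℝ) (hS : 0 ≤ S) (hA : 0 ≤ A) :
    ∃ (R₀ : ℕ) (ε m₀ : ℝ), 0 < R₀ ∧ 0 < ε ∧
      32 * ε * (S * ε + A) + (S + A / ε) / (R₀ : ℝ) ^ 2 < m₀ ∧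
      ∃ L₀ : ℕ, ∀ (L : ℕ) [NeZero L], L₀ ≤ L → Even L →
        ∀ ψ : Fock (Orb (FermionTorus 2 L)), star ψ ⬝ᵥ ψ = 1 →
          IsGroundStateInSector (hubbardTorus 2 L 1 U) (2 * ⌊(1 - δ) * (L : ℝ) ^ 2 / 2⌋₊) 0 ψ →
            m₀ * (R₀ : ℝ) ^ 2 ≤ (∑ x : TorusSite 2 L, ∑ y : TorusSite 2 L,
              (∏ i : Fin 2, max 0 (1 - |(((y i - x i).valMinAbs : ℤ) : ℝ)| / (R₀ : ℝ))) *
                (star (localPair dWaveFormFactor L x *ᵥ ψ) ⬝ᵥ (localPair dWaveFormFactor L y *ᵥ ψ)).re) /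
              (L : ℝ) ^ 2 := by
  obtain ⟨R₀, hR₀, L₀, h⟩ := hsup (12 * A + 3 * S + 1)
  have hRpos : (0 : ℝ) < R₀ := Nat.cast_pos.2 hR₀
  have hR1 : (1 : ℝ) ≤ R₀ := by exact_mod_cast hR₀
  refine ⟨R₀, 1 / (4 * R₀), (12 * A + 3 * S + 1) / R₀, hR₀, by positivity, ?_, L₀, ?_⟩
  · -- the leak at `ε = 1/(4R₀)` is `3S/R₀² + 12A/R₀ < (12A + 3S + 1)/R₀`
    have e : 32 * (1 / (4 * (R₀ : ℝ))) * (S * (1 / (4 * (R₀ : ℝ))) + A) +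
        (S + A / (1 / (4 * (R₀ : ℝ)))) / (R₀ : ℝ) ^ 2 =
          3 * S / (R₀ : ℝ) ^ 2 + 12 * A / (R₀ : ℝ) := by
      field_simp
      ring
    rw [e]
    have h1 : 3 * S / (R₀ : ℝ) ^ 2 ≤ 3 * S / (R₀ : ℝ) := by
      apply div_le_div_of_nonneg_left (by positivity) hRpos
      nlinarith
    have h2 : 3 * S / (R₀ : ℝ) + 12 * A / (R₀ : ℝ) < (12 * A + 3 * S + 1) / (R₀ : ℝ) := by
      rw [← add_div, div_lt_div_iff_of_pos_right hRpos]
      linarith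
    linarith
  · intro L _ hL hE ψ hψ hgs
    have h' := h L hL hE ψ hψ hgs
    have e : (12 * A + 3 * S + 1) / (R₀ : ℝ) * (R₀ : ℝ) ^ 2 = (12 * A + 3 * S + 1) * (R₀ : ℝ) := by
      field_simp
    rw [e]
    exact h'

/-- **(GS)-body ∧ (Flat)-body ⇒ (A)-body, at a point** (eventual form of `profile_of_shape_of_flat`): the
window Goldstone shape with constants `(A, ε₀)` and the flat law off the window `|q_m| > ε₀` with constant
`S` give the Goldstone pair profile `S_ψ(m) ≤ S + A/|q_m|` (`m ≠ 0`). [folklore] -/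
theorem profileAt_of_shapeAt_of_flatAt {U δ S A ε₀ : ℝ} {L_G L_F : ℕ} (hS : 0 ≤ S) (hA : 0 ≤ A)
    (hshape : ∀ (L : ℕ) [NeZero L], L_G ≤ L → Even L →
      ∀ ψ : Fock (Orb (FermionTorus 2 L)), star ψ ⬝ᵥ ψ = 1 →
        IsGroundStateInSector (hubbardTorus 2 L 1 U) (2 * ⌊(1 - δ) * (L : ℝ) ^ 2 / 2⌋₊) 0 ψ →
          ∀ m : TorusSite 2 L, m ≠ 0 → momentumNormSq L m ≤ ε₀ ^ 2 →
            pairStructureFactor dWaveFormFactor L ψ m * Real.sqrt (momentumNormSq L m) ≤ A)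
    (hflat : ∀ (L : ℕ) [NeZero L], L_F ≤ L → Even L →
      ∀ ψ : Fock (Orb (FermionTorus 2 L)), star ψ ⬝ᵥ ψ = 1 →
        IsGroundStateInSector (hubbardTorus 2 L 1 U) (2 * ⌊(1 - δ) * (L : ℝ) ^ 2 / 2⌋₊) 0 ψ →
          ∀ m : TorusSite 2 L, ε₀ ^ 2 < momentumNormSq L m →
            pairStructureFactor dWaveFormFactor L ψ m ≤ S) :
    ∀ (L : ℕ) [NeZero L], max L_G L_F ≤ L → Even L →
      ∀ ψ : Fock (Orb (FermionTorus 2 L)), star ψ ⬝ᵥ ψ = 1 →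
        IsGroundStateInSector (hubbardTorus 2 L 1 U) (2 * ⌊(1 - δ) * (L : ℝ) ^ 2 / 2⌋₊) 0 ψ →
          ∀ m : TorusSite 2 L, m ≠ 0 →
            pairStructureFactor dWaveFormFactor L ψ m ≤ S + A / Real.sqrt (momentumNormSq L m) := by
  intro L _ hL hE ψ hψ hgs m hm
  exact profile_of_shape_of_flat hS hA (pairStructureFactor dWaveFormFactor L ψ)
    (hshape L (le_of_max_le_left hL) hE ψ hψ hgs) (hflat L (le_of_max_le_right hL) hE ψ hψ hgs) hm

/-- **THE FOUR STUB BODIES AT ONE COMMON POINT ⇒ CRUX ∧ SUMMIT.** At a point `U > 0`, `δ ∈ (0, 1/2)`: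
the (GS)-body (window Goldstone shape), the (Flat)-body (flat law off every window), the (Q)-body (a
floor at every fixed block scale) and the (D)-body (a doubling law with one `θ > 2` beyond some `R₁`) —
each eventually in even `L`, over every normalised `(N_L, 0)`-sector ground state of `hubbardTorus 2 L 1 U` —
imply `MesoscopicPairOrder` AND the summit `HubbardSuperconductivity`. Chain: (GS) ∧ (Flat) ⇒ profile
`(S(ε₀), A)`; (Q) ∧ (D) ⇒ super-linear block pair order (`superlinearAt_of_floorAt_of_doublingAt`) ⇒ a
leak-beating seed for that budget (`seedAt_of_superlinearAt`) ⇒ uniform sector pair order at `(U, δ)`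
(`uniformPairOrderAt_of_profileAt_of_seedAt`) ⇒ the crux (`mesoscopicPairOrder_of_uniformPairOrder`) and
the summit (`summitMatrix_of_everyGSOrder`). So the line needs its four stubs at ONE point only. [folklore] -/
theorem meso_and_summit_of_stubBodiesAt {U δ : ℝ} (hU : 0 < U) (hδ : δ ∈ Set.Ioo (0:ℝ) (1 / 2))
    (hGS : ∃ A ε₀ : ℝ, 0 ≤ A ∧ 0 < ε₀ ∧ ∃ L₀ : ℕ, ∀ (L : ℕ) [NeZero L], L₀ ≤ L → Even L →
      ∀ ψ : Fock (Orb (FermionTorus 2 L)), star ψ ⬝ᵥ ψ = 1 →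
        IsGroundStateInSector (hubbardTorus 2 L 1 U) (2 * ⌊(1 - δ) * (L : ℝ) ^ 2 / 2⌋₊) 0 ψ →
          ∀ m : TorusSite 2 L, m ≠ 0 → momentumNormSq L m ≤ ε₀ ^ 2 →
            pairStructureFactor dWaveFormFactor L ψ m * Real.sqrt (momentumNormSq L m) ≤ A)
    (hFlat : ∀ η : ℝ, 0 < η → ∃ S : ℝ, 0 ≤ S ∧ ∃ L₀ : ℕ, ∀ (L : ℕ) [NeZero L], L₀ ≤ L → Even L →
      ∀ ψ : Fock (Orb (FermionTorus 2 L)), star ψ ⬝ᵥ ψ = 1 →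
        IsGroundStateInSector (hubbardTorus 2 L 1 U) (2 * ⌊(1 - δ) * (L : ℝ) ^ 2 / 2⌋₊) 0 ψ →
          ∀ m : TorusSite 2 L, η ^ 2 < momentumNormSq L m →
            pairStructureFactor dWaveFormFactor L ψ m ≤ S)
    (hQ : ∀ R : ℕ, 0 < R → ∃ c : ℝ, 0 < c ∧ ∃ L₀ : ℕ, ∀ (L : ℕ) [NeZero L], L₀ ≤ L → Even L →
      ∀ ψ : Fock (Orb (FermionTorus 2 L)), star ψ ⬝ᵥ ψ = 1 →
        IsGroundStateInSector (hubbardTorus 2 L 1 U) (2 * ⌊(1 - δ) * (L : ℝ) ^ 2 / 2⌋₊) 0 ψ →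
          c ≤ (∑ x : TorusSite 2 L, ∑ y : TorusSite 2 L,
            (∏ i : Fin 2, max 0 (1 - |(((y i - x i).valMinAbs : ℤ) : ℝ)| / (R : ℝ))) *
              (star (localPair dWaveFormFactor L x *ᵥ ψ) ⬝ᵥ (localPair dWaveFormFactor L y *ᵥ ψ)).re) /
            (L : ℝ) ^ 2)
    (hD : ∃ θ : ℝ, 2 < θ ∧ ∃ R₁ : ℕ, ∀ R : ℕ, R₁ ≤ R → ∃ L₀ : ℕ, ∀ (L : ℕ) [NeZero L], L₀ ≤ L → Even L →
      ∀ ψ : Fock (Orb (FermionTorus 2 L)), star ψ ⬝ᵥ ψ = 1 →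
        IsGroundStateInSector (hubbardTorus 2 L 1 U) (2 * ⌊(1 - δ) * (L : ℝ) ^ 2 / 2⌋₊) 0 ψ →
          θ * (∑ x : TorusSite 2 L, ∑ y : TorusSite 2 L,
            (∏ i : Fin 2, max 0 (1 - |(((y i - x i).valMinAbs : ℤ) : ℝ)| / (R : ℝ))) *
              (star (localPair dWaveFormFactor L x *ᵥ ψ) ⬝ᵥ (localPair dWaveFormFactor L y *ᵥ ψ)).re) ≤
          (∑ x : TorusSite 2 L, ∑ y : TorusSite 2 L,
            (∏ i : Fin 2, max 0 (1 - |(((y i - x i).valMinAbs : ℤ) : ℝ)| / ((2 * R : ℕ) : ℝ))) *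
              (star (localPair dWaveFormFactor L x *ᵥ ψ) ⬝ᵥ (localPair dWaveFormFactor L y *ᵥ ψ)).re)) :
    MesoscopicPairOrder ∧ _root_.HubbardSuperconductivity := by
  -- (GS) ∧ (Flat) ⇒ profile with constants `(S, A)`, `S` = the flat constant at `η = ε₀`
  obtain ⟨A, ε₀, hA, hε₀, L_G, hshape⟩ := hGS
  obtain ⟨S, hS, L_F, hflat⟩ := hFlat ε₀ hε₀
  have hprof := profileAt_of_shapeAt_of_flatAt (U := U) (δ := δ) hS hA hshape hflat
  -- (Q) ∧ (D) ⇒ super-linear ⇒ seed for the budget `(S, A)`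
  obtain ⟨θ, hθ, R₁, hDθ⟩ := hD
  have hsup := superlinearAt_of_floorAt_of_doublingAt (U := U) (δ := δ) hθ hQ hDθ
  obtain ⟨R₀, ε, m₀, hR₀, hε, hleak, L_B, hseed⟩ := seedAt_of_superlinearAt hsup S A hS hA
  -- one-scale closure ⇒ uniform sector pair order at `(U, δ)`
  obtain ⟨a, ha, L₀, hupo⟩ :=
    uniformPairOrderAt_of_profileAt_of_seedAt (U := U) (δ := δ) hS hA hR₀ hε hleak hprof hseed
  refine ⟨mesoscopicPairOrder_of_uniformPairOrder ⟨U, hU, δ, hδ, a, ha, L₀, hupo⟩, U, hU, δ, hδ, ?_⟩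
  refine Summit.HubbardSuperconductivity.TwTipContinuation.Negative.summitMatrix_of_everyGSOrder
    ⟨a, ha, L₀, fun L _ hL hE ψ hψ1 hgs => ?_⟩
  have h := hupo L hL hE ψ hψ1 hgs
  have hLpos : (0 : ℝ) < L := Nat.cast_pos.2 (Nat.pos_of_ne_zero (NeZero.ne L))
  rwa [le_div_iff₀ (by positivity : (0 : ℝ) < (L : ℝ) ^ 4)] at h

/-- **THE BOX-RESTRICTED LINE CLOSES THE CRUX.** If (GS) and (Flat) hold at every point of the box
`U ∈ (0,6]`, `δ ∈ [1/10, 3/10]` (instead of at all `U > 0`, `δ ∈ (0,1/2)` as registered), (Q) holds on the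
box (verbatim the registered `stub_pairFluctuationFloor`) and (D) holds at some point of the box (verbatim the
registered `stub_coherenceDoubling`), then `MesoscopicPairOrder ∧ HubbardSuperconductivity`: apply
`meso_and_summit_of_stubBodiesAt` at (D)'s witness. This is the composition theorem of the reshaped
skeleton in which no stub is exposed outside the box. [folklore] -/
theorem meso_and_summit_of_boxStubs
    (hGS : ∀ U : ℝ, U ∈ Set.Ioc (0:ℝ) 6 → ∀ δ : ℝ, δ ∈ Set.Icc (1 / 10 : ℝ) (3 / 10) →
      ∃ A ε₀ : ℝ, 0 ≤ A ∧ 0 < ε₀ ∧ ∃ L₀ : ℕ, ∀ (L : ℕ) [NeZero L], L₀ ≤ L → Even L →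
        ∀ ψ : Fock (Orb (FermionTorus 2 L)), star ψ ⬝ᵥ ψ = 1 →
          IsGroundStateInSector (hubbardTorus 2 L 1 U) (2 * ⌊(1 - δ) * (L : ℝ) ^ 2 / 2⌋₊) 0 ψ →
            ∀ m : TorusSite 2 L, m ≠ 0 → momentumNormSq L m ≤ ε₀ ^ 2 →
              pairStructureFactor dWaveFormFactor L ψ m * Real.sqrt (momentumNormSq L m) ≤ A)
    (hFlat : ∀ U : ℝ, U ∈ Set.Ioc (0:ℝ) 6 → ∀ δ : ℝ, δ ∈ Set.Icc (1 / 10 : ℝ) (3 / 10) →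
      ∀ η : ℝ, 0 < η → ∃ S : ℝ, 0 ≤ S ∧ ∃ L₀ : ℕ, ∀ (L : ℕ) [NeZero L], L₀ ≤ L → Even L →
        ∀ ψ : Fock (Orb (FermionTorus 2 L)), star ψ ⬝ᵥ ψ = 1 →
          IsGroundStateInSector (hubbardTorus 2 L 1 U) (2 * ⌊(1 - δ) * (L : ℝ) ^ 2 / 2⌋₊) 0 ψ →
            ∀ m : TorusSite 2 L, η ^ 2 < momentumNormSq L m →
              pairStructureFactor dWaveFormFactor L ψ m ≤ S)
    (hQ : ∀ U : ℝ, U ∈ Set.Ioc (0:ℝ) 6 → ∀ δ : ℝ, δ ∈ Set.Icc (1 / 10 : ℝ) (3 / 10) → ∀ R : ℕ, 0 < R →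
      ∃ c : ℝ, 0 < c ∧ ∃ L₀ : ℕ, ∀ (L : ℕ) [NeZero L], L₀ ≤ L → Even L →
        ∀ ψ : Fock (Orb (FermionTorus 2 L)), star ψ ⬝ᵥ ψ = 1 →
          IsGroundStateInSector (hubbardTorus 2 L 1 U) (2 * ⌊(1 - δ) * (L : ℝ) ^ 2 / 2⌋₊) 0 ψ →
            c ≤ (∑ x : TorusSite 2 L, ∑ y : TorusSite 2 L,
              (∏ i : Fin 2, max 0 (1 - |(((y i - x i).valMinAbs : ℤ) : ℝ)| / (R : ℝ))) *
                (star (localPair dWaveFormFactor L x *ᵥ ψ) ⬝ᵥ (localPair dWaveFormFactor L y *ᵥ ψ)).re) /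
              (L : ℝ) ^ 2)
    (hD : ∃ U : ℝ, U ∈ Set.Ioc (0:ℝ) 6 ∧ ∃ δ : ℝ, δ ∈ Set.Icc (1 / 10 : ℝ) (3 / 10) ∧ ∃ θ : ℝ, 2 < θ ∧
      ∃ R₁ : ℕ, ∀ R : ℕ, R₁ ≤ R → ∃ L₀ : ℕ, ∀ (L : ℕ) [NeZero L], L₀ ≤ L → Even L →
        ∀ ψ : Fock (Orb (FermionTorus 2 L)), star ψ ⬝ᵥ ψ = 1 →
          IsGroundStateInSector (hubbardTorus 2 L 1 U) (2 * ⌊(1 - δ) * (L : ℝ) ^ 2 / 2⌋₊) 0 ψ →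
            θ * (∑ x : TorusSite 2 L, ∑ y : TorusSite 2 L,
              (∏ i : Fin 2, max 0 (1 - |(((y i - x i).valMinAbs : ℤ) : ℝ)| / (R : ℝ))) *
                (star (localPair dWaveFormFactor L x *ᵥ ψ) ⬝ᵥ (localPair dWaveFormFactor L y *ᵥ ψ)).re) ≤
            (∑ x : TorusSite 2 L, ∑ y : TorusSite 2 L,
              (∏ i : Fin 2, max 0 (1 - |(((y i - x i).valMinAbs : ℤ) : ℝ)| / ((2 * R : ℕ) : ℝ))) *
                (star (localPair dWaveFormFactor L x *ᵥ ψ) ⬝ᵥ (localPair dWaveFormFactor L y *ᵥ ψ)).re)) :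
    MesoscopicPairOrder ∧ _root_.HubbardSuperconductivity := by
  obtain ⟨U, hU, δ, hδ, θ, hθ, R₁, hDθ⟩ := hD
  have hUpos : 0 < U := hU.1
  have hδ' : δ ∈ Set.Ioo (0:ℝ) (1 / 2) := ⟨by linarith [hδ.1], by linarith [hδ.2]⟩
  exact meso_and_summit_of_stubBodiesAt hUpos hδ' (hGS U hU δ hδ) (hFlat U hU δ hδ) (hQ U hU δ hδ)
    ⟨θ, hθ, R₁, hDθ⟩

/-- Registered sub-goal form (line `redirect_birth`, lead c9): the BOX-RESTRICTED line closes the crux and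
the summit — (GS), (Flat), (Q) on the box `(0,6] × [1/10,3/10]`, (D) verbatim the registered stub ⇒
`MesoscopicPairOrder ∧ HubbardSuperconductivity` (`meso_and_summit_of_boxStubs`). [folklore] -/
theorem mesoAndSummitOfBoxStubs : (∀ U : ℝ, U ∈ Set.Ioc (0:ℝ) 6 → ∀ δ : ℝ, δ ∈ Set.Icc (1 / 10 : ℝ) (3 / 10) → ∃ A ε₀ : ℝ, 0 ≤ A ∧ 0 < ε₀ ∧ ∃ L₀ : ℕ, ∀ (L : ℕ) [NeZero L], L₀ ≤ L → Even L → ∀ ψ : Fock (Orb (FermionTorus 2 L)), star ψ ⬝ᵥ ψ = 1 → IsGroundStateInSector (hubbardTorus 2 L 1 U) (2 * ⌊(1 - δ) * (L : ℝ) ^ 2 / 2⌋₊) 0 ψ → ∀ m : TorusSite 2 L, m ≠ 0 → momentumNormSq L m ≤ ε₀ ^ 2 → pairStructureFactor dWaveFormFactor L ψ m * Real.sqrt (momentumNormSq L m) ≤ A) → (∀ U : ℝ, U ∈ Set.Ioc (0:ℝ) 6 → ∀ δ : ℝ, δ ∈ Set.Icc (1 / 10 : ℝ) (3 / 10) → ∀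 η : ℝ, 0 < η → ∃ S : ℝ, 0 ≤ S ∧ ∃ L₀ : ℕ, ∀ (L : ℕ) [NeZero L], L₀ ≤ L → Even L → ∀ ψ : Fock (Orb (FermionTorus 2 L)), star ψ ⬝ᵥ ψ = 1 → IsGroundStateInSector (hubbardTorus 2 L 1 U) (2 * ⌊(1 - δ) * (L : ℝ) ^ 2 / 2⌋₊) 0 ψ → ∀ m : TorusSite 2 L, η ^ 2 < momentumNormSq L m → pairStructureFactor dWaveFormFactor L ψ m ≤ S) → (∀ U : ℝ, U ∈ Set.Ioc (0:ℝ) 6 → ∀ δ : ℝ, δ ∈ Set.Icc (1 / 10 : ℝ) (3 / 10) → ∀ R : ℕ, 0 < R → ∃ c : ℝ, 0 < c ∧ ∃ L₀ : ℕ, ∀ (L : ℕ) [NeZero L], L₀ ≤ L → Even L → ∀ ψ : Fock (Orb (FermionTorus 2 L)), star ψ ⬝ᵥ ψ = 1 → IsGroundStateInSector (hubbardTorus 2 L 1 U) (2 * ⌊(1 - δ) * (L : ℝ) ^ 2 / 2⌋₊) 0 ψ → c ≤ (∑ x : TorusSite 2 L, ∑ y : TorusSite 2 L, (∏ i : Fin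 2, max 0 (1 - |(((y i - x i).valMinAbs : ℤ) : ℝ)| / (R : ℝ))) * (star (localPair dWaveFormFactor L x *ᵥ ψ) ⬝ᵥ (localPair dWaveFormFactor L y *ᵥ ψ)).re) / (L : ℝ) ^ 2) → (∃ U : ℝ, U ∈ Set.Ioc (0:ℝ) 6 ∧ ∃ δ : ℝ, δ ∈ Set.Icc (1 / 10 : ℝ) (3 / 10) ∧ ∃ θ : ℝ, 2 < θ ∧ ∃ R₁ : ℕ, ∀ R : ℕ, R₁ ≤ R → ∃ L₀ : ℕ, ∀ (L : ℕ) [NeZero L], L₀ ≤ L → Even L → ∀ ψ : Fock (Orb (FermionTorus 2 L)), star ψ ⬝ᵥ ψ = 1 → IsGroundStateInSector (hubbardTorus 2 L 1 U) (2 * ⌊(1 - δ) * (L : ℝ) ^ 2 / 2⌋₊) 0 ψ → θ * (∑ x : TorusSite 2 L, ∑ y : TorusSite 2 L, (∏ i : Fin 2, max 0 (1 - |(((y i - x i).valMinAbs : ℤ) : ℝ)| / (R : ℝ))) * (star (localPair dWaveFormFactor L x *ᵥ ψ) ⬝ᵥ (localPair dWaveFormFactor L y *ᵥ ψ)).re)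 ≤ (∑ x : TorusSite 2 L, ∑ y : TorusSite 2 L, (∏ i : Fin 2, max 0 (1 - |(((y i - x i).valMinAbs : ℤ) : ℝ)| / ((2 * R : ℕ) : ℝ))) * (star (localPair dWaveFormFactor L x *ᵥ ψ) ⬝ᵥ (localPair dWaveFormFactor L y *ᵥ ψ)).re)) → Summit.HubbardSuperconductivity.HubbardSuperconductivity.Theses.FunctionFieldCertificate.MesoscopicPairOrder ∧ _root_.HubbardSuperconductivity :=
  meso_and_summit_of_boxStubs

end Summit.HubbardSuperconductivity.HubbardSuperconductivity.Theorems.FunctionFieldCertificate
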